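import Summits.MatrixMultiplication.MatrixMultiplication.Theorems.DefinableSTPPDichotomyHexagonClearanceRRadicalLemmas

/-!
# `DefinableSTPPDichotomy.HexagonClearanceR` — stub `stub_radicalNormalForm` (line `Sketch`, stub 6a)

RADICAL NORMAL FORM / GENERIC SEPARABILITY (assembly; the algebra is in the sibling file
`DefinableSTPPDichotomyHexagonClearanceRRadicalLemmas`).  Over a finite field `F` of characteristic
`> D`, the one-variable polynomials `G_l ∈ F[w][t]` of a normal form may be replaced, without changing
any of the sets `{w : ∃t G_l(w,t)=0}`, by polynomials `S_l` (radicals) such that off the zero set `E` of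
one nonzero polynomial `B ∈ F[w]` of bounded degree every `F`-rational root of `t ↦ S_l(w,t)` is simple.
-/

set_option linter.dupNamespace false

open Polynomial

namespace Summit.MatrixMultiplication.MatrixMultiplication.Theorems.HexagonClearanceR

open Radical in
/-- **Stub 6a of line `Sketch`: radical normal form / generic separability.**  Constants:
`D' := 2D + 1`, `Q := D + 1` (characteristic `> D`), `C₀ := L · (4D² + 2D)`.  For `G_l = 0` take
`S_l := t`; otherwise `S_l := rad(G_l)` in the UFD `F[w][t]` (same zeros fibrewise, since
`S_l ∣ G_l ∣ S_l^n`; degrees bounded through `F[X_0..X_m]`).  The exceptional set is the zero set of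
`B := ∏_l b_l`, `b_l := Res_t(S_l, ∂_t S_l)` (or the constant `S_l` itself when `deg_t S_l = 0`, or `1`):
`B ≠ 0` by separability of `S_l` over `F(w)` (§1), `|E| ≤ deg B · |F|^{m-1}` (Schwartz–Zippel, §5,
with the Leibniz bound §4), and off `E` every rational root of `S_l(w, ·)` is simple by the specialised
Bézout identity (§2). -/
theorem stub_radicalNormalForm :
    (∀ (m L D : ℕ), ∃ (D' Q : ℕ) (C₀ : ℝ), ∀ (F : Type) [Field F] [Fintype F],
        Q ≤ ringChar F → ∀ (G : Fin L → Polynomial (MvPolynomial (Fin m) F)),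
          (∀ l, (G l).natDegree ≤ D ∧ ∀ k, ((G l).coeff k).totalDegree ≤ D) →
          ∃ S : Fin L → Polynomial (MvPolynomial (Fin m) F),
          (∀ l, (S l).natDegree ≤ D' ∧ ∀ k, ((S l).coeff k).totalDegree ≤ D') ∧
          (∀ l (w : Fin m → F),
            (∃ t : F, Polynomial.eval t (Polynomial.map (MvPolynomial.eval w) (G l)) = 0) ↔
            (∃ t : F, Polynomial.eval t (Polynomial.map (MvPolynomial.eval w) (S l)) = 0)) ∧
          ∃ E : Finset (Fin m → F), (E.card : ℝ) ≤ C₀ * (Fintype.card F : ℝ) ^ ((m : ℝ) - 1) ∧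
            ∀ w : Fin m → F, w ∉ E → ∀ l (t : F),
              Polynomial.eval t (Polynomial.map (MvPolynomial.eval w) (S l)) = 0 →
              Polynomial.eval t (Polynomial.derivative (Polynomial.map (MvPolynomial.eval w) (S l))) ≠ 0) := by
  intro m L D
  refine ⟨2 * D + 1, D + 1, ((L * (4 * D * D + 2 * D) : ℕ) : ℝ), ?_⟩
  intro F _ _ hchar G hG
  classical
  letI : NormalizationMonoid (Polynomial (MvPolynomial (Fin m) F)) :=
    (UniqueFactorizationMonoid.strongNormalizationMonoid).toNormalizationMonoid
  -- the radicals and their basic properties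
  set rad : Fin L → Polynomial (MvPolynomial (Fin m) F) :=
    fun l => UniqueFactorizationMonoid.radical (G l) with hrad
  have hrad_dvd : ∀ l, rad l ∣ G l := fun l => UniqueFactorizationMonoid.radical_dvd_self
  have hrad_sq : ∀ l, Squarefree (rad l) := fun l => UniqueFactorizationMonoid.squarefree_radical
  have hrad0 : ∀ l, rad l ≠ 0 := fun l => (hrad_sq l).ne_zero
  have hrad_pow : ∀ l, G l ≠ 0 → ∃ n, G l ∣ rad l ^ n := fun l hl =>
    UniqueFactorizationMonoid.exists_dvd_radical_self_pow hl
  have hrad_deg : ∀ l, G l ≠ 0 → (rad l).natDegree ≤ D := fun l hl =>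
    (natDegree_le_of_dvd (hrad_dvd l) hl).trans (hG l).1
  have hrad_coeff : ∀ l, G l ≠ 0 → ∀ k, ((rad l).coeff k).totalDegree ≤ 2 * D := fun l hl k =>
    totalDegree_coeff_le_of_dvd hl (hrad_dvd l) (hG l).1 (hG l).2 k
  have hcharD : D < ringChar F := Nat.lt_of_lt_of_le (Nat.lt_succ_self D) hchar
  -- the resultant of a positive-degree radical with its derivative is nonzero
  have hres : ∀ l, G l ≠ 0 → 0 < (rad l).natDegree →
      resultant (rad l) (derivative (rad l)) (rad l).natDegree ((rad l).natDegree - 1) ≠ 0 := by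
    intro l hl hd
    refine resultant_derivative_ne_zero (rad l) (hrad_sq l) hd ?_ ?_
    · exact natCast_ne_zero_of_lt_ringChar hd ((hrad_deg l hl).trans_lt hcharD)
    · intro p _ hp hpd
      have hple : p.natDegree ≤ (rad l).natDegree := natDegree_le_of_dvd hp (hrad0 l)
      exact derivative_ne_zero_of_natDegree_lt p hpd
        ((hple.trans (hrad_deg l hl)).trans_lt hcharD)
  -- the new polynomials, the bad polynomials, the exceptional set
  let S : Fin L → Polynomial (MvPolynomial (Fin m) F) := fun l => if G l = 0 then X else rad l
  let b : Fin L → MvPolynomial (Fin m) F := fun l =>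
    if G l = 0 then 1 else
      if (rad l).natDegree = 0 then (rad l).coeff 0
      else resultant (rad l) (derivative (rad l)) (rad l).natDegree ((rad l).natDegree - 1)
  have hb0 : ∀ l, b l ≠ 0 := by
    intro l
    by_cases hl : G l = 0
    · simp only [b, hl, if_true]; exact one_ne_zero
    · by_cases hd : (rad l).natDegree = 0
      · simp only [b, hl, hd, if_true, if_false]
        intro h0
        apply hrad0 l
        rw [eq_C_of_natDegree_eq_zero hd, h0, C_0]
      · simp only [b, hl, hd, if_false]
        exact hres l hl (Nat.pos_of_ne_zero hd)
  have hbdeg : ∀ l, (b l).totalDegree ≤ 4 * D * D + 2 * D := by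
    intro l
    by_cases hl : G l = 0
    · simp only [b, hl, if_true, MvPolynomial.totalDegree_one]; exact Nat.zero_le _
    · by_cases hd : (rad l).natDegree = 0
      · simp only [b, hl, hd, if_true, if_false]
        exact (hrad_coeff l hl 0).trans (by nlinarith)
      · simp only [b, hl, hd, if_false]
        refine (totalDegree_resultant_le _ _ _ _ (hrad_coeff l hl)
          (totalDegree_coeff_derivative_le _ (hrad_coeff l hl))).trans ?_
        have h1 : (rad l).natDegree + ((rad l).natDegree - 1) ≤ 2 * D := by
          have := hrad_deg l hl; omega
        calc ((rad l).natDegree + ((rad l).natDegree - 1)) * (2 * D) ≤ (2 * D) * (2 * D) :=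
              Nat.mul_le_mul_right _ h1
          _ ≤ 4 * D * D + 2 * D := by nlinarith
  set B : MvPolynomial (Fin m) F := ∏ l, b l with hB
  have hB0 : B ≠ 0 := Finset.prod_ne_zero_iff.2 fun l _ => hb0 l
  have hBdeg : B.totalDegree ≤ L * (4 * D * D + 2 * D) := by
    refine (MvPolynomial.totalDegree_finsetProd _ _).trans ?_
    calc ∑ l, (b l).totalDegree ≤ ∑ _l : Fin L, (4 * D * D + 2 * D) :=
          Finset.sum_le_sum fun l _ => hbdeg l
      _ = L * (4 * D * D + 2 * D) := by simp
  refine ⟨S, ?_, ?_, Finset.univ.filter (fun w => MvPolynomial.eval w B = 0), ?_, ?_⟩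
  · -- degrees of the `S l`
    intro l
    by_cases hl : G l = 0
    · simp only [S, hl, if_true]
      refine ⟨natDegree_X_le.trans (by omega), fun k => ?_⟩
      rw [coeff_X]
      split_ifs
      · rw [MvPolynomial.totalDegree_one]; exact Nat.zero_le _
      · rw [MvPolynomial.totalDegree_zero]; exact Nat.zero_le _
    · simp only [S, hl, if_false]
      exact ⟨(hrad_deg l hl).trans (by omega), fun k => (hrad_coeff l hl k).trans (by omega)⟩
  · -- same zero sets, fibrewise
    intro l w
    by_cases hl : G l = 0
    · simp only [S, hl, if_true, Polynomial.map_zero, eval_zero, exists_const, Polynomial.map_X,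
        eval_X, exists_eq]
    · simp only [S, hl, if_false]
      obtain ⟨n, hn⟩ := hrad_pow l hl
      exact exists_root_iff_of_dvd_of_dvd_pow (hrad_dvd l) hn w
  · -- size of the exceptional set
    refine (card_zeros_le B hB0).trans ?_
    have hq : (0 : ℝ) ≤ (Fintype.card F : ℝ) ^ ((m : ℝ) - 1) :=
      Real.rpow_nonneg (Nat.cast_nonneg _) _
    exact mul_le_mul_of_nonneg_right (by exact_mod_cast hBdeg) hq
  · -- off `E` every rational root of `S l (w, ·)` is simple
    intro w hw l t ht
    have hBw : MvPolynomial.eval w B ≠ 0 := by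
      intro h0
      exact hw (Finset.mem_filter.2 ⟨Finset.mem_univ _, h0⟩)
    have hbw : MvPolynomial.eval w (b l) ≠ 0 := by
      rw [hB, map_prod] at hBw
      exact (Finset.prod_ne_zero_iff.1 hBw) l (Finset.mem_univ _)
    by_cases hl : G l = 0
    · simp only [S, hl, if_true, Polynomial.map_X, derivative_X, eval_one]
      exact one_ne_zero
    · simp only [S, hl, if_false] at ht ⊢
      by_cases hd : (rad l).natDegree = 0
      · -- constant in `t`: no roots off `E`
        exfalso
        simp only [b, hl, hd, if_true, if_false] at hbw
        rw [eq_C_of_natDegree_eq_zero hd, map_C, eval_C] at ht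
        exact hbw ht
      · simp only [b, hl, hd, if_false] at hbw
        exact eval_derivative_ne_zero_of_resultant (rad l) le_rfl hd w hbw t ht

end Summit.MatrixMultiplication.MatrixMultiplication.Theorems.HexagonClearanceR
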